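import Summits.CriticalPhenomena.PercolationContinuityZ3.Theorems.PercNearOneGluingNoHeavyLowerTailSunflowerOpenProductPositivity
import Summits.CriticalPhenomena.PercolationContinuityZ3.Theorems.PercNearOneGluingNoHeavyLowerTailSunflowerSeriesEvalGeom

/-!
# `NoHeavyLowerTail` (crux stmt-CriticalPhenomena-4575), abstract sunflower cubic: THE REAL MÖBIUS CERTIFICATE
# Part A — the real factors `t_S[φ]`, their power-series evaluation, `0 < t_S ≤ 1`, the full product, and the CHORD INEQUALITY

Support file (seat `prim-ineq-prove-1` gen 46; `--supports stmt-CriticalPhenomena-4575`).  No `sorry`.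
Memo: run/shared/lean/prim/prim-ineq-prove-1/FINDING-PAR-prove1-g46.md §2 (i), (iv).
For `φ : ι → ℝ` with `φ ≥ 0`, `∑ φ < 1`:
    `tR φ S = (∏_{B ⊆ S, #(S∖B) even} (1 - φ(B))) · (∏_{B ⊆ S, #(S∖B) odd} (1 - φ(B)))⁻¹`,   `FR φ 𝒰 = ∏_{S ∈ 𝒰} tR φ S`.
* `ev_tS` / `ev_prod_tS`: `tR φ S` (`FR φ 𝒰`) is the value at `φ` of the formal factor `OpenProduct.tS S` (of `∏ tS`);
* `tR_pos`, **`tR_le_one`** (from (PAR) for the family `{S}`), `prod_tR_powerset` (`∏_{S ⊆ U} tR φ S = 1 - φ(U)`),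
  **`one_sub_le_FR`** (`1 - φ(⋃𝒰) ≤ FR φ 𝒰`: the `|R| = 0` case of the grain induction);
* `tR_eq_one_of_eq_zero` (`tR φ S = 1` if `φ j = 0` for some `j ∈ S`), `FR_scale_zero`;
* **`FR_chord`**: for UNION-CLOSED `𝒰`, `K ⊆ ι` and `q ∈ [0,1]`, with `ψ^{K,q} = ψ` scaled by `q` on `K`,
      `q · FR ψ 𝒰 + (1 - q) · FR ψ^{K,0} 𝒰 ≤ FR ψ^{K,q} 𝒰`
  (concavity of `q ↦ F_𝒰[ψ^{K,q}]` between `0` and `1`; from (PAR) `OpenProduct.coeff_one_sub_prod_tS_nonneg` through the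
  evaluation bridge `SeriesEval`).
-/

namespace Summit.CriticalPhenomena.PercolationContinuityZ3.Theorems.SunflowerPartition

namespace Grain

open Finset MvPowerSeries OpenProduct SeriesEval

variable {ι : Type*} [Fintype ι] [DecidableEq ι]

/-- The real Möbius factor `t_S[φ] = ∏_{B ⊆ S} (1 - φ(B))^{(-1)^{#(S∖B)}}`. [this work] -/
noncomputable def tR (φ : ι → ℝ) (S : Finset ι) : ℝ :=
  (∏ B ∈ S.powerset with Even (S \ B).card, (1 - ∑ j ∈ B, φ j)) *
    (∏ B ∈ S.powerset with ¬ Even (S \ B).card, (1 - ∑ j ∈ B, φ j))⁻¹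

/-- The real certificate product `F_𝒰[φ] = ∏_{S ∈ 𝒰} t_S[φ]`. [this work] -/
noncomputable def FR (φ : ι → ℝ) (𝒰 : Finset (Finset ι)) : ℝ := ∏ S ∈ 𝒰, tR φ S

/-- `ψ^{K,q}`: scale `ψ` by `q` on the coordinates in `K`. [this work] -/
def scale (K : Finset ι) (q : ℝ) (ψ : ι → ℝ) : ι → ℝ := fun i => if i ∈ K then q * ψ i else ψ i

section Basic

variable {φ : ι → ℝ}

omit [DecidableEq ι] in
/-- A subset sum of a nonnegative family with total `< 1` is `< 1`. [this work] -/
theorem sum_lt_one_of_subset (hφ : ∀ i, 0 ≤ φ i) (h1 : ∑ i, φ i < 1) (B : Finset ι) : ∑ j ∈ B, φ j < 1 :=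
  lt_of_le_of_lt (sum_le_sum_of_subset_of_nonneg (subset_univ B) fun i _ _ => hφ i) h1

/-- `t_S[φ] > 0`. [this work] -/
theorem tR_pos (hφ : ∀ i, 0 ≤ φ i) (h1 : ∑ i, φ i < 1) (S : Finset ι) : 0 < tR φ S := by
  unfold tR
  refine mul_pos (prod_pos fun B _ => ?_) (inv_pos.mpr (prod_pos fun B _ => ?_)) <;>
    linarith [sum_lt_one_of_subset hφ h1 B]

/-- `F_𝒰[φ] > 0`. [this work] -/
theorem FR_pos (hφ : ∀ i, 0 ≤ φ i) (h1 : ∑ i, φ i < 1) (𝒰 : Finset (Finset ι)) : 0 < FR φ 𝒰 :=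
  prod_pos fun S _ => tR_pos hφ h1 S

omit [Fintype ι] in
/-- Splitting a parity-filtered product over the subsets of `insert j S₀` (`j ∉ S₀`). [this work] -/
theorem prod_filter_powerset_insert (P : ℕ → Prop) [DecidablePred P] (g : Finset ι → ℝ) (S₀ : Finset ι) (j : ι)
    (hj : j ∉ S₀) :
    ∏ B ∈ (insert j S₀).powerset with P ((insert j S₀) \ B).card, g B =
      (∏ B ∈ S₀.powerset with P ((S₀ \ B).card + 1), g B) * ∏ B ∈ S₀.powerset with P (S₀ \ B).card, g (insert j B) := by
  rw [Finset.prod_filter, prod_powerset_insert hj, Finset.prod_filter, Finset.prod_filter]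
  congr 1
  · refine prod_congr rfl fun B hB => ?_
    have hB' : B ⊆ S₀ := mem_powerset.mp hB
    have h1 : insert j S₀ \ B = insert j (S₀ \ B) := by
      ext a; simp only [mem_sdiff, mem_insert]
      constructor
      · rintro ⟨h | h, hnb⟩
        · exact Or.inl h
        · exact Or.inr ⟨h, hnb⟩
      · rintro (h | ⟨h, hnb⟩)
        · exact ⟨Or.inl h, fun hb => hj (h ▸ hB' hb)⟩
        · exact ⟨Or.inr h, hnb⟩
    rw [h1, card_insert_of_notMem (fun h => hj (mem_sdiff.mp h).1)]
  · refine prod_congr rfl fun B hB => ?_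
    have hB' : B ⊆ S₀ := mem_powerset.mp hB
    have h2 : insert j S₀ \ insert j B = S₀ \ B := by
      ext a; simp only [mem_sdiff, mem_insert]
      constructor
      · rintro ⟨h | h, hnb⟩
        · exact absurd (Or.inl h) hnb
        · exact ⟨h, fun hb => hnb (Or.inr hb)⟩
      · rintro ⟨h, hnb⟩
        exact ⟨Or.inr h, fun hb => hb.elim (fun hb => hj (hb ▸ h)) hnb⟩
    rw [h2]

/-- `t_S[φ] = 1` as soon as `φ j = 0` for some `j ∈ S` (pair `B ↔ B ∪ {j}`). [this work] -/
theorem tR_eq_one_of_eq_zero (hφ : ∀ i, 0 ≤ φ i) (h1 : ∑ i, φ i < 1) (S : Finset ι) (j : ι) (hj : j ∈ S)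
    (hj0 : φ j = 0) : tR φ S = 1 := by
  unfold tR
  obtain ⟨S₀, hjS₀, rfl⟩ : ∃ S₀, j ∉ S₀ ∧ S = insert j S₀ := ⟨S.erase j, notMem_erase j S, (insert_erase hj).symm⟩
  have hins : ∀ B ∈ S₀.powerset, (1 - ∑ k ∈ insert j B, φ k) = 1 - ∑ k ∈ B, φ k := by
    intro B hB
    rw [sum_insert (fun h => hjS₀ (mem_powerset.mp hB h)), hj0, zero_add]
  rw [prod_filter_powerset_insert (fun n => Even n) _ S₀ j hjS₀,
    prod_filter_powerset_insert (fun n => ¬ Even n) _ S₀ j hjS₀]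
  rw [prod_congr rfl fun B hB => hins B (mem_filter.mp hB).1,
    prod_congr rfl (s₁ := S₀.powerset.filter fun B => ¬ Even (S₀ \ B).card) fun B hB => hins B (mem_filter.mp hB).1]
  simp only [Nat.even_add_one, not_not]
  rw [mul_comm (∏ B ∈ S₀.powerset with ¬Even (S₀ \ B).card, (1 - ∑ k ∈ B, φ k))]
  refine mul_inv_cancel₀ (mul_ne_zero (prod_ne_zero_iff.mpr fun B _ => ?_) (prod_ne_zero_iff.mpr fun B _ => ?_)) <;>
    linarith [sum_lt_one_of_subset hφ h1 B]

omit [Fintype ι] in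
/-- `t_S[φ]` only depends on `φ` restricted to `S`. [this work] -/
theorem tR_congr {φ ψ : ι → ℝ} (S : Finset ι) (h : ∀ j ∈ S, φ j = ψ j) : tR φ S = tR ψ S := by
  unfold tR
  have : ∀ B ∈ S.powerset, (1 - ∑ j ∈ B, φ j) = 1 - ∑ j ∈ B, ψ j := fun B hB =>
    by rw [sum_congr rfl fun j hj => h j (mem_powerset.mp hB hj)]
  rw [prod_congr rfl fun B hB => this B (mem_filter.mp hB).1,
    prod_congr rfl (s₁ := S.powerset.filter fun B => ¬ Even (S \ B).card) fun B hB => this B (mem_filter.mp hB).1]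

/-! ## Scaling -/

omit [Fintype ι] in
/-- `ψ^{K,1} = ψ`. [this work] -/
theorem scale_one (K : Finset ι) (ψ : ι → ℝ) : scale K 1 ψ = ψ := by
  funext i; simp [scale]

omit [Fintype ι] in
/-- `ψ^{K,q} ≥ 0`. [this work] -/
theorem scale_nonneg (K : Finset ι) {q : ℝ} (hq : 0 ≤ q) {ψ : ι → ℝ} (hψ : ∀ i, 0 ≤ ψ i) (i : ι) :
    0 ≤ scale K q ψ i := by
  unfold scale; split_ifs
  · exact mul_nonneg hq (hψ i)
  · exact hψ i

omit [Fintype ι] in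
/-- `ψ^{K,q} ≤ ψ` for `q ≤ 1`. [this work] -/
theorem scale_le (K : Finset ι) {q : ℝ} (hq1 : q ≤ 1) {ψ : ι → ℝ} (hψ : ∀ i, 0 ≤ ψ i) (i : ι) :
    scale K q ψ i ≤ ψ i := by
  unfold scale; split_ifs
  · nlinarith [hψ i]
  · exact le_rfl

/-- `∑ ψ^{K,q} < 1` when `∑ ψ < 1`, `q ≤ 1`. [this work] -/
theorem sum_scale_lt_one (K : Finset ι) {q : ℝ} (hq1 : q ≤ 1) {ψ : ι → ℝ} (hψ : ∀ i, 0 ≤ ψ i)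
    (h1 : ∑ i, ψ i < 1) : ∑ i, scale K q ψ i < 1 :=
  lt_of_le_of_lt (sum_le_sum fun i _ => scale_le K hq1 hψ i) h1

/-- `F_𝒰[ψ^{K,0}] = F_{𝒰 ∩ 2^{Kᶜ}}[ψ]`: the factors meeting `K` become `1`. [this work] -/
theorem FR_scale_zero (K : Finset ι) {ψ : ι → ℝ} (hψ : ∀ i, 0 ≤ ψ i) (h1 : ∑ i, ψ i < 1) (𝒰 : Finset (Finset ι)) :
    FR (scale K 0 ψ) 𝒰 = FR ψ (𝒰.filter fun S => ∀ j ∈ S, j ∉ K) := by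
  unfold FR
  rw [← prod_filter_mul_prod_filter_not 𝒰 (fun S => ∀ j ∈ S, j ∉ K)]
  have hsc0 : ∀ i, 0 ≤ scale K 0 ψ i := scale_nonneg K le_rfl hψ
  have hsc1 : ∑ i, scale K 0 ψ i < 1 := sum_scale_lt_one K zero_le_one hψ h1
  rw [prod_congr rfl (s₁ := 𝒰.filter fun S => ¬ ∀ j ∈ S, j ∉ K) (g := fun _ => (1 : ℝ)) fun S hS => ?_]
  · rw [prod_const_one, mul_one]
    refine prod_congr rfl fun S hS => tR_congr S fun j hj => ?_
    simp [scale, (mem_filter.mp hS).2 j hj]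
  · obtain ⟨hS𝒰, hSK⟩ := mem_filter.mp hS
    push Not at hSK
    obtain ⟨j, hjS, hjK⟩ := hSK
    exact tR_eq_one_of_eq_zero hsc0 hsc1 S j hjS (by simp [scale, hjK])

/-! ## The evaluation bridge: `tR φ S` is the value of the formal factor `tS S` at `φ` -/

/-- `t_S[φ] = ev φ (tS S)` and absolute convergence, for `φ ≥ 0`, `∑ φ < 1`. [this work] -/
theorem ev_tS (hφ : ∀ i, 0 ≤ φ i) (h1 : ∑ i, φ i < 1) (S : Finset ι) :
    AbsConv φ (tS S : MvPowerSeries ι ℚ) ∧ ev φ (tS S) = tR φ S := by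
  have hB : ∀ B : Finset ι, ∑ j ∈ B, φ j < 1 := sum_lt_one_of_subset hφ h1
  unfold tS tR
  rw [prod_inv_eq]
  have hN := ev_prod hφ (S.powerset.filter fun B => Even (S \ B).card)
    (fun B => (1 - ∑ a ∈ B, X a : MvPowerSeries ι ℚ)) fun B _ => absConv_one_sub_sum_X hφ B
  have hD := ev_prod hφ (S.powerset.filter fun B => ¬ Even (S \ B).card)
    (fun B => (1 - ∑ a ∈ B, X a : MvPowerSeries ι ℚ)⁻¹) fun B _ => absConv_inv_one_sub hφ B (hB B)
  refine ⟨hN.1.mul hφ hD.1, ?_⟩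
  rw [ev_mul hφ hN.1 hD.1, hN.2, hD.2, prod_congr rfl fun B _ => ev_one_sub_sum_X hφ B,
    prod_congr rfl fun B _ => ev_inv_one_sub hφ B (hB B), prod_inv_distrib]

/-- `F_𝒰[φ] = ev φ (∏_{S∈𝒰} tS S)` and absolute convergence. [this work] -/
theorem ev_prod_tS (hφ : ∀ i, 0 ≤ φ i) (h1 : ∑ i, φ i < 1) (𝒰 : Finset (Finset ι)) :
    AbsConv φ (∏ S ∈ 𝒰, tS S : MvPowerSeries ι ℚ) ∧ ev φ (∏ S ∈ 𝒰, tS S) = FR φ 𝒰 := by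
  have h := ev_prod hφ 𝒰 (fun S => (tS S : MvPowerSeries ι ℚ)) fun S _ => (ev_tS hφ h1 S).1
  exact ⟨h.1, by rw [h.2, FR]; exact prod_congr rfl fun S _ => (ev_tS hφ h1 S).2⟩

/-! ## `t_S ≤ 1`, the full product, and the `|R| = 0` inequality -/

omit [DecidableEq ι] in
/-- The value of a nonnegative-coefficient absolutely convergent series at `x ≥ 0` is nonnegative. [this work] -/
theorem ev_nonneg_of_coeff_nonneg {x : ι → ℝ} (hx : ∀ i, 0 ≤ x i) (P : MvPowerSeries ι ℚ)
    (hP : ∀ n, 0 ≤ coeff n P) : 0 ≤ ev x P :=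
  tsum_nonneg fun β => mul_nonneg (by exact_mod_cast hP β) (mono_nonneg hx β)

/-- **`t_S[φ] ≤ 1`** (from (PAR) for the one-member family `{S}`). [this work] -/
theorem tR_le_one (hφ : ∀ i, 0 ≤ φ i) (h1 : ∑ i, φ i < 1) (S : Finset ι) : tR φ S ≤ 1 := by
  have hpar : ∀ n, 0 ≤ coeff n (1 - ∏ S' ∈ ({S} : Finset (Finset ι)), tS S' : MvPowerSeries ι ℚ) :=
    coeff_one_sub_prod_tS_nonneg {S} (fun A hA B hB => by
      rw [mem_singleton] at hA hB; rw [hA, hB, union_idempotent]; exact mem_singleton_self _)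
  have hev := ev_prod_tS hφ h1 ({S} : Finset (Finset ι))
  have h0 := ev_nonneg_of_coeff_nonneg hφ _ hpar
  rw [ev_sub hφ absConv_one hev.1, ev_one, hev.2, FR, prod_singleton] at h0
  linarith

/-- `0 < F_𝒰[φ] ≤ 1`. [this work] -/
theorem FR_le_one (hφ : ∀ i, 0 ≤ φ i) (h1 : ∑ i, φ i < 1) (𝒰 : Finset (Finset ι)) : FR φ 𝒰 ≤ 1 :=
  prod_le_one (fun S _ => (tR_pos hφ h1 S).le) fun S _ => tR_le_one hφ h1 S

/-- Formal full product over the subsets of `U`: `∏_{S ⊆ U} T m S = U m U` (as `prod_T_powerset_univ`). [this work] -/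
theorem prod_T_powerset {A : Type*} [DecidableEq A] {m : Finset A → MvPowerSeries A ℚ} (hm : IsConfig m)
    (W : Finset A) : ∏ S ∈ W.powerset, T m hm S = OpenProduct.U m hm W := by
  unfold T
  rw [Finset.prod_comm' (t' := W.powerset) (s' := fun B => W.powerset.filter fun S => B ⊆ S)
        (h := by
          intro S B
          simp only [mem_powerset, mem_filter]
          constructor
          · rintro ⟨hS, hB⟩; exact ⟨⟨hS, hB⟩, hB.trans hS⟩
          · rintro ⟨⟨hS, hB⟩, _⟩; exact ⟨hS, hB⟩)]
  simp_rw [prod_zpow_eq_zpow_sum]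
  rw [← Finset.prod_erase_mul _ _ (mem_powerset.mpr (Subset.refl W))]
  rw [sum_sgn_Icc_eq' W W (Subset.refl _), if_pos rfl, zpow_one]
  rw [Finset.prod_eq_one, one_mul]
  intro B hB
  have hB' : B ≠ W := (mem_erase.mp hB).1
  rw [sum_sgn_Icc_eq' B W (mem_powerset.mp (mem_erase.mp hB).2), if_neg hB', zpow_zero]

omit [Fintype ι] in
/-- `∏_{S ⊆ U} tS S = 1 - ∑_{a ∈ U} X a` (formal). [this work] -/
theorem prod_tS_powerset (W : Finset ι) :
    (∏ S ∈ W.powerset, tS S : MvPowerSeries ι ℚ) = 1 - ∑ a ∈ W, X a := by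
  rw [← y_m0 W, ← val_U isConfig_m0 W, ← prod_T_powerset isConfig_m0 W, Units.coe_prod]
  exact prod_congr rfl fun S _ => (val_T_m0 S).symm

/-- `∏_{S ⊆ U} t_S[φ] = 1 - φ(U)` (real). [this work] -/
theorem prod_tR_powerset (hφ : ∀ i, 0 ≤ φ i) (h1 : ∑ i, φ i < 1) (W : Finset ι) :
    FR φ W.powerset = 1 - ∑ a ∈ W, φ a := by
  rw [← (ev_prod_tS hφ h1 W.powerset).2, prod_tS_powerset, ev_one_sub_sum_X hφ]

/-- **The `|R| = 0` inequality**: `1 - φ(U) ≤ F_𝒰[φ]` whenever every member of `𝒰` lies inside `U`. [this work] -/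
theorem one_sub_le_FR (hφ : ∀ i, 0 ≤ φ i) (h1 : ∑ i, φ i < 1) (𝒰 : Finset (Finset ι)) (W : Finset ι)
    (h𝒰 : ∀ S ∈ 𝒰, S ⊆ W) : 1 - ∑ a ∈ W, φ a ≤ FR φ 𝒰 := by
  have hsub : 𝒰 ⊆ W.powerset := fun S hS => mem_powerset.mpr (h𝒰 S hS)
  rw [← prod_tR_powerset hφ h1 W, FR, ← prod_sdiff hsub]
  calc (∏ S ∈ W.powerset \ 𝒰, tR φ S) * ∏ S ∈ 𝒰, tR φ S ≤ 1 * ∏ S ∈ 𝒰, tR φ S := by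
        exact mul_le_mul_of_nonneg_right (FR_le_one hφ h1 _) (FR_pos hφ h1 𝒰).le
    _ = FR φ 𝒰 := one_mul _

/-! ## The chord inequality -/

/-- `mono (ψ^{K,q}) β = q ^ (∑_{i∈K} β i) · mono ψ β`. [this work] -/
theorem mono_scale (K : Finset ι) (q : ℝ) (ψ : ι → ℝ) (β : ι →₀ ℕ) :
    mono (scale K q ψ) β = q ^ (∑ i ∈ K, β i) * mono ψ β := by
  unfold mono scale
  have : ∀ i, (if i ∈ K then q * ψ i else ψ i) ^ β i = (if i ∈ K then q else 1) ^ β i * ψ i ^ β i := by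
    intro i; split_ifs <;> simp [mul_pow]
  simp_rw [this]
  rw [prod_mul_distrib, ← prod_pow_eq_pow_sum]
  congr 1
  rw [← Finset.prod_filter_mul_prod_filter_not univ (fun i => i ∈ K)]
  rw [prod_congr rfl (s₁ := univ.filter fun i => ¬ i ∈ K) (g := fun _ => (1 : ℝ)) fun i hi => by
      rw [if_neg (mem_filter.mp hi).2, one_pow]]
  rw [prod_const_one, mul_one]
  have hK : univ.filter (fun i => i ∈ K) = K := by ext i; simp
  rw [hK]
  exact prod_congr rfl fun i hi => by rw [if_pos hi]

/-- **CHORD INEQUALITY.**  For a UNION-CLOSED `𝒰`, `ψ ≥ 0` with `∑ ψ < 1`, `K` and `q ∈ [0,1]`: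
`q · F_𝒰[ψ] + (1 - q) · F_𝒰[ψ^{K,0}] ≤ F_𝒰[ψ^{K,q}]` — the function `q ↦ F_𝒰[ψ^{K,q}]` lies above its chord.
From (PAR): `1 - F_𝒰 = ∑_β c_β x^β` with `c_β ≥ 0`, and `q^n ≤ q · 1 + (1 - q) · 0^n`. [this work] -/
theorem FR_chord (𝒰 : Finset (Finset ι)) (h𝒰 : ∀ S ∈ 𝒰, ∀ S' ∈ 𝒰, S ∪ S' ∈ 𝒰) {ψ : ι → ℝ}
    (hψ : ∀ i, 0 ≤ ψ i) (h1 : ∑ i, ψ i < 1) (K : Finset ι) {q : ℝ} (hq0 : 0 ≤ q) (hq1 : q ≤ 1) :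
    q * FR ψ 𝒰 + (1 - q) * FR (scale K 0 ψ) 𝒰 ≤ FR (scale K q ψ) 𝒰 := by
  set P : MvPowerSeries ι ℚ := 1 - ∏ S ∈ 𝒰, tS S with hP
  have hc : ∀ β, 0 ≤ coeff β P := coeff_one_sub_prod_tS_nonneg 𝒰 h𝒰
  -- evaluation of `P` at the three points
  have hevP : ∀ r : ℝ, 0 ≤ r → r ≤ 1 →
      ev (scale K r ψ) P = 1 - FR (scale K r ψ) 𝒰 ∧
      ev (scale K r ψ) P = ∑' β, ((coeff β P : ℚ) : ℝ) * r ^ (∑ i ∈ K, β i) * mono ψ β := by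
    intro r hr0 hr1
    have hx : ∀ i, 0 ≤ scale K r ψ i := scale_nonneg K hr0 hψ
    have hx1 : ∑ i, scale K r ψ i < 1 := sum_scale_lt_one K hr1 hψ h1
    have hF := ev_prod_tS hx hx1 𝒰
    refine ⟨by rw [hP, ev_sub hx absConv_one hF.1, ev_one, hF.2], ?_⟩
    unfold ev
    exact tsum_congr fun β => by rw [term, mono_scale]; ring
  have hsum : Summable fun β => ((coeff β P : ℚ) : ℝ) * mono ψ β := by
    have hF := ev_prod_tS hψ h1 𝒰
    have hA : AbsConv ψ P := absConv_one.sub hψ hF.1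
    have := hA.summable hψ
    exact this
  have key := tsum_pow_mul_le_chord (fun β => ((coeff β P : ℚ) : ℝ)) (fun β => mono ψ β)
    (fun β => ∑ i ∈ K, β i) (fun β => by exact_mod_cast hc β) (fun β => mono_nonneg hψ β) hsum q hq0 hq1
  obtain ⟨hq_a, hq_b⟩ := hevP q hq0 hq1
  obtain ⟨h1_a, h1_b⟩ := hevP 1 zero_le_one le_rfl
  obtain ⟨h0_a, h0_b⟩ := hevP 0 le_rfl zero_le_one
  rw [scale_one] at h1_a h1_b
  have e1 : ∑' β, ((coeff β P : ℚ) : ℝ) * mono ψ β = 1 - FR ψ 𝒰 := by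
    rw [← h1_a, h1_b]; exact tsum_congr fun β => by rw [one_pow, mul_one]
  rw [← hq_b, hq_a, e1, ← h0_b, h0_a] at key
  linarith

end Basic

end Grain

end Summit.CriticalPhenomena.PercolationContinuityZ3.Theorems.SunflowerPartition
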